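import Summits.AtomisticToContinuum.Crystallization.Theorems.FrustratedLawDichotomyCoherentFloor
import Literature.MathematicalPhysics.StatisticalMechanics.LennardJonesClusters

/-!
# FrustratedLawDichotomy · crux `AperiodicFrustratedLawGap` (stmt-AtomisticToContinuum-27623) — THE `hin`-FREE CLASS-A DOOR
(cell decomp-a2c, lens-5 g114; FINDING «TEMPLATE-COMPLETENESS», STATUS 2026-09-04T15:2xZ)

## Why this file exists

The class-A door of record `…CoherentFloor.certFloor_le_two_mul_rootEnergy(_of_nash)` ((226)/(244)) carries the hypothesis
`hin : ∀ x ∈ a, ‖x‖ + τ ≤ Rc` (every template tube inside the window) AND, through `coherentAt`, the clause «no atom of the configuration in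
`B̄(0, Rc)` outside the template balls».  For a τ-perturbed FULL lattice the two are jointly unsatisfiable at any radius without a radial gap of
width `2τ` in the lattice's distance set (there is none near `r = 13` at `τ = 2⁻¹⁰`: the F1 template of record `MF1` — sites whose tube is inside
`B̄(13)` for every strain of the box — leaves ≥ 60 occupied sites in the shell `12.98 < r < 13`, so NO perturbed full F1 lattice lies in the row `KF1`).
The rows are sound but uninhabited; the atlas credit vanishes.

## The repair typed here (R-door)

Drop `hin`.  Coherence alone gives «atoms in the window ⊆ template atoms» (`…CoherentWindow.inter_closedBall_subset_image_atomOf`, which never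
used `hin`), so
* §1 the window functional is the template sum over the template atoms that LIE in the window:
  `∫_{B̄(0,R)} f d(count⌊S) = Σ_{x ∈ a, atomOf x ∈ B̄(0,R)} f (atomOf x)` (`setIntegral_closedBall_eq_sum_filter`), hence
  `Σ_{x ∈ a} f (atomOf x) ≤ ∫_{B̄(0,R)} f d(count⌊S)` as soon as `f (atomOf x) ≤ 0` for the template atoms OUTSIDE the window
  (`sum_atomOf_le_setIntegral_closedBall`) — for `f = V_LJ ∘ ‖·‖` and `R ≥ 1` automatic (`V_LJ ≤ 0` on `[1, ∞)`); a template atom outside the window is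
  then counted twice (template sum AND energy tail), both times with a non-positive value: the floor only drops, by ≤ (#collar sites)·|V(R − 2τ)|
  (F1: 88 · 3.5·10⁻⁸);
* §2 the force column splits the NASH balance into the template atoms (wherever they are) and the NON-template atoms, all of which lie outside
  `B̄(0,Rc)` by the same inclusion (`norm_sum_template_force_le'`), with the far column `farCol (Rc − (‖x‖ + τ))` unchanged;
* §3 ★ `certFloor_le_two_mul_rootEnergy'` / `certFloor_le_two_mul_rootEnergy_of_nash'` = (226)/(244) VERBATIM MINUS `hin` — same certificate
  `certFloor a I y τ Rc`, same columns, same K-file format.  Cells may (and must) now use COMPLETE templates: every site whose tube MEETS the window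
  for some strain of the box (F1: `(1 − 3ε)|Tz|² ≤ (13 + τ)²`, 14 153 labels), which a perturbed full lattice satisfies.

House conventions: SI units · italic scalars, bold vectors, sans-serif tensors · numbered formulae only when referenced · en-dash for ranges ·
References = cited works, numbered, alphabetical · no footnotes; Remarks at section ends · British spelling, -ise · Lennard-Jones hyphenated; NASH
capitalised as the Statement's notion · "folklore" tags standard bookkeeping; no new references are cited in this file.
0 defs · 0 sorry · imports the tree's `…CoherentFloor` only.
-/

noncomputable section

namespace Summit.AtomisticToContinuum.Crystallization.Theorems.FrustratedLawDichotomyCoherentFloorComplete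

open MeasureTheory Metric Set Filter RealInnerProductSpace
open scoped BigOperators Topology ENNReal
open Literature.MathematicalPhysics.StatisticalMechanics (lennardJones rootEnergy rootEnergy_def)
open Literature.Probability.Process (IsRootedHardCore count_restrict_singleton_ne_zero_iff)
open Summit.AtomisticToContinuum.Crystallization.Theorems.ChargedEnergyGapNegative (E3)
open Summit.AtomisticToContinuum.Crystallization.Theorems.FrustratedLawDichotomyCoherentSets (coherentAt)
open Summit.AtomisticToContinuum.Crystallization.Theorems.FrustratedLawDichotomyCoherentWindow
open Summit.AtomisticToContinuum.Crystallization.Theorems.FrustratedLawDichotomyFarForceColumn (sum_norm_force_le_sevenTenths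
  sum_norm_force_le_sevenTenths_of_far_from_root)
open Summit.AtomisticToContinuum.Crystallization.Theorems.FrustratedLawDichotomyTransportPriceTail (countable_of_separated
  integrable_lennardJones_of_isRootedHardCore)
open Literature.Probability.Process.LocalConfig (finite_inter_of_separated)
open Summit.AtomisticToContinuum.Crystallization.Theorems.FrustratedLawDichotomyNashForceBalance (hasSum_force_of_nash)
open Summit.AtomisticToContinuum.Crystallization.Theorems.FrustratedLawDichotomyCoherentFloorAlgebra
open Summit.AtomisticToContinuum.Crystallization.Theorems.FrustratedLawDichotomyCoherentFloor

variable {S : Set E3} {δ τ R : ℝ} {a : Finset E3}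

/-! ## §1. Window functionals WITHOUT `hin`: the template atoms that lie in the window -/

open scoped Classical in
/-- **Window = the template atoms lying in it** (no `hin`): on a coherent window of a separated configuration,
`S ∩ B̄(0,R) = atomOf '' {x ∈ a | atomOf x ∈ B̄(0,R)}`. [folklore] -/
theorem inter_closedBall_eq_image_filter (hS : ∀ p ∈ S, ∀ p' ∈ S, p ≠ p' → δ ≤ dist p p') (hτ : 2 * τ < δ)
    (h : (Measure.count.restrict S : Measure E3) ∈ coherentAt a τ R) :
    S ∩ closedBall (0 : E3) R = atomOf S τ '' ((a.filter fun x => atomOf S τ x ∈ closedBall (0 : E3) R : Finset E3) : Set E3) := by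
  classical
  apply Set.Subset.antisymm
  · intro p hp
    obtain ⟨x, hx, hpx⟩ := inter_closedBall_subset_image_atomOf hS hτ h hp
    refine ⟨x, ?_, hpx⟩
    rw [Finset.coe_filter]
    exact ⟨hx, by rw [hpx]; exact hp.2⟩
  · rintro _ ⟨x, hx, rfl⟩
    rw [Finset.coe_filter] at hx
    exact ⟨(atomOf_mem_of_mem_coherentAt h hx.1).2, hx.2⟩

open scoped Classical in
/-- The configuration restricted to the window is the counting measure of those template atoms (no `hin`). [folklore] -/
theorem restrict_closedBall_eq_count_image_filter (hS : ∀ p ∈ S, ∀ p' ∈ S, p ≠ p' → δ ≤ dist p p') (hτ : 2 * τ < δ)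
    (h : (Measure.count.restrict S : Measure E3) ∈ coherentAt a τ R) :
    (Measure.count.restrict S : Measure E3).restrict (closedBall (0 : E3) R) =
      Measure.count.restrict ((((a.filter fun x => atomOf S τ x ∈ closedBall (0 : E3) R).image (atomOf S τ) : Finset E3)) : Set E3) := by
  classical
  rw [Measure.restrict_restrict measurableSet_closedBall, Set.inter_comm, inter_closedBall_eq_image_filter hS hτ h, Finset.coe_image]

open scoped Classical in
/-- ★ **WINDOW FUNCTIONALS WITHOUT `hin`.**  For every `f : E3 → ℝ`,
`∫ z in B̄(0,R), f z ∂(count⌊S) = Σ_{x ∈ a, atomOf x ∈ B̄(0,R)} f (atomOf x)`. [folklore] -/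
theorem setIntegral_closedBall_eq_sum_filter (hS : ∀ p ∈ S, ∀ p' ∈ S, p ≠ p' → δ ≤ dist p p') (hτ : 2 * τ < δ)
    (h : (Measure.count.restrict S : Measure E3) ∈ coherentAt a τ R)
    (ha : ∀ x ∈ a, ∀ x' ∈ a, x ≠ x' → 2 * τ < dist x x') (f : E3 → ℝ) :
    ∫ z in closedBall (0 : E3) R, f z ∂(Measure.count.restrict S : Measure E3) =
      ∑ x ∈ a.filter (fun x => atomOf S τ x ∈ closedBall (0 : E3) R), f (atomOf S τ x) := by
  classical
  have hne : ∀ x ∈ a, (closedBall x τ ∩ S).Nonempty := fun x hx => nonempty_of_mem_coherentAt h hx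
  rw [restrict_closedBall_eq_count_image_filter hS hτ h,
    Literature.MathematicalPhysics.StatisticalMechanics.integral_count_restrict_coe_finset,
    Finset.sum_image fun x hx x' hx' hxx' =>
      injOn_atomOf ha hne (Finset.mem_of_mem_filter x hx) (Finset.mem_of_mem_filter x' hx') hxx']

/-- ★ **THE TEMPLATE SUM IS BELOW THE WINDOW FUNCTIONAL** whenever `f` is non-positive on the template atoms OUTSIDE the window
(no `hin`; the dropped terms are `≤ 0`). [folklore] -/
theorem sum_atomOf_le_setIntegral_closedBall (hS : ∀ p ∈ S, ∀ p' ∈ S, p ≠ p' → δ ≤ dist p p') (hτ : 2 * τ < δ)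
    (h : (Measure.count.restrict S : Measure E3) ∈ coherentAt a τ R)
    (ha : ∀ x ∈ a, ∀ x' ∈ a, x ≠ x' → 2 * τ < dist x x') (f : E3 → ℝ)
    (hneg : ∀ x ∈ a, atomOf S τ x ∉ closedBall (0 : E3) R → f (atomOf S τ x) ≤ 0) :
    ∑ x ∈ a, f (atomOf S τ x) ≤ ∫ z in closedBall (0 : E3) R, f z ∂(Measure.count.restrict S : Measure E3) := by
  classical
  rw [setIntegral_closedBall_eq_sum_filter hS hτ h ha f,
    ← Finset.sum_filter_add_sum_filter_not a (fun x => atomOf S τ x ∈ closedBall (0 : E3) R)]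
  have h0 : ∑ x ∈ a.filter (fun x => ¬ atomOf S τ x ∈ closedBall (0 : E3) R), f (atomOf S τ x) ≤ 0 :=
    Finset.sum_nonpos fun x hx => hneg x (Finset.mem_of_mem_filter x hx) (Finset.mem_filter.mp hx).2
  linarith

/-- ★ **THE TRUNCATED TEMPLATE ENERGY IS BELOW THE WINDOW ENERGY** (no `hin`, `R ≥ 1`): a template atom outside `B̄(0,R)` has `V_LJ ≤ 0`. [folklore] -/
theorem sum_lennardJones_atomOf_le_setIntegral (hS : ∀ p ∈ S, ∀ p' ∈ S, p ≠ p' → δ ≤ dist p p') (hτ : 2 * τ < δ)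
    (h : (Measure.count.restrict S : Measure E3) ∈ coherentAt a τ R)
    (ha : ∀ x ∈ a, ∀ x' ∈ a, x ≠ x' → 2 * τ < dist x x') (hR : 1 ≤ R) :
    ∑ x ∈ a, lennardJones ‖atomOf S τ x‖ ≤ ∫ z in closedBall (0 : E3) R, lennardJones ‖z‖ ∂(Measure.count.restrict S : Measure E3) := by
  refine sum_atomOf_le_setIntegral_closedBall hS hτ h ha (fun z => lennardJones ‖z‖) fun x _ hx => ?_
  rw [mem_closedBall_zero_iff, not_le] at hx
  exact Literature.MathematicalPhysics.StatisticalMechanics.lennardJones_nonpos (hR.trans hx.le)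

/-! ## §2. The force column WITHOUT `hin`: template atoms vs. non-template atoms -/

/-- ★ **THE FORCE-BALANCE SPLIT WITHOUT `hin`.**  If the actual atom `q_x = atomOf S τ x` of a template site `x ∈ a`, at least `7/20` inside the
window, is in force equilibrium, then the force on it from the OTHER TEMPLATE ATOMS (wherever they are) is at most `T0(Rc − (‖x‖ + τ))`: the
complementary atoms are not template atoms, hence — the window's atoms being template atoms — lie outside `B̄(0,Rc)`. [folklore] -/
theorem norm_sum_template_force_le' {S : Set E3} {τ Rc : ℝ} {a : Finset E3}
    (hS : ∀ p ∈ S, ∀ p' ∈ S, p ≠ p' → (7 : ℝ) / 10 ≤ dist p p') (hτ : 2 * τ < 7 / 10)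
    (hcoh : (Measure.count.restrict S : Measure E3) ∈ coherentAt a τ Rc)
    (ha : ∀ x ∈ a, ∀ x' ∈ a, x ≠ x' → 2 * τ < dist x x')
    {x : E3} (hx : x ∈ a) (hR : 7 / 20 ≤ Rc - (‖x‖ + τ))
    (hbal : HasSum (fun q : {q : E3 // (Measure.count.restrict S : Measure E3) {q} ≠ 0 ∧ q ≠ atomOf S τ x} =>
      ((dist (atomOf S τ x) (q : E3))⁻¹ ^ 8 - (dist (atomOf S τ x) (q : E3))⁻¹ ^ 14) • (atomOf S τ x - (q : E3))) 0) :
    ‖∑ x' ∈ a.erase x, ljBondForce (atomOf S τ x - atomOf S τ x')‖ ≤ farCol (Rc - (‖x‖ + τ)) := by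
  classical
  have h7 : (0 : ℝ) < 7 / 10 := by norm_num
  have hne : ∀ z ∈ a, (closedBall z τ ∩ S).Nonempty := fun z hz => nonempty_of_mem_coherentAt hcoh hz
  set p : E3 := atomOf S τ x with hp
  have hpS : p ∈ S := (atomOf_mem (hne x hx)).2
  have hpn : ‖p‖ ≤ ‖x‖ + τ := norm_atomOf_le (hne x hx)
  set T := {q : E3 // (Measure.count.restrict S : Measure E3) {q} ≠ 0 ∧ q ≠ p}
  set f : T → E3 := fun q => ((dist p (q : E3))⁻¹ ^ 8 - (dist p (q : E3))⁻¹ ^ 14) • (p - (q : E3)) with hf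
  have hmemT : ∀ q : T, (q : E3) ∈ S ∧ (q : E3) ≠ p := fun q =>
    ⟨(count_restrict_singleton_ne_zero_iff S q).mp q.2.1, q.2.2⟩
  have hdistT : ∀ q : T, (7 : ℝ) / 10 ≤ dist (q : E3) p := fun q => hS _ (hmemT q).1 p hpS (hmemT q).2
  -- the norms are summable: every finite column is at most `T0(7/10)`
  have hnorm : Summable fun q : T => ‖f q‖ := by
    refine summable_of_sum_le (fun q => norm_nonneg _) (c := farCol (7 / 10)) fun u => ?_
    have hmap : ∑ q ∈ u, ‖f q‖ =
        ∑ q ∈ u.map (Function.Embedding.subtype _), ‖((dist p q)⁻¹ ^ 8 - (dist p q)⁻¹ ^ 14) • (p - q)‖ := by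
      rw [Finset.sum_map]; rfl
    rw [hmap]
    unfold farCol
    refine sum_norm_force_le_sevenTenths _ p (by norm_num) (fun q hq q' hq' hqq' => ?_) (fun q hq => ?_)
    · obtain ⟨w, -, rfl⟩ := Finset.mem_map.mp hq
      obtain ⟨w', -, rfl⟩ := Finset.mem_map.mp hq'
      exact hS _ (hmemT w).1 _ (hmemT w').1 hqq'
    · obtain ⟨w, -, rfl⟩ := Finset.mem_map.mp hq
      exact hdistT w
  -- the TEMPLATE part of `T` (no `hin`: indexed by the template, not by the window)
  set tpl : Finset E3 := (a.erase x).image (atomOf S τ) with htpl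
  have hnear : {q : T | (q : E3) ∈ (tpl : Set E3)}.Finite :=
    Finite.of_injOn (f := fun q : T => (q : E3)) (t := (tpl : Set E3)) (fun q hq => hq) Subtype.val_injective.injOn tpl.finite_toSet
  set s : Finset T := hnear.toFinset with hs
  have hsplit := hbal.summable.sum_add_tsum_compl (s := s)
  rw [hbal.tsum_eq] at hsplit
  have hsum_s : ∑ q ∈ s, f q = -∑' q : ↑((↑s : Set T)ᶜ), f q := eq_neg_of_add_eq_zero_left hsplit
  -- complement points are NOT template atoms, hence lie outside the window (the window's atoms are template atoms)
  have hfar : ∀ q : ↑((↑s : Set T)ᶜ), Rc ≤ dist ((q : T) : E3) (0 : E3) := fun q => by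
    have h1 : (q : T) ∉ (↑s : Set T) := q.2
    have h2 : (q : T) ∉ hnear.toFinset := h1
    rw [Finite.mem_toFinset] at h2
    have h3 : ((q : T) : E3) ∉ (tpl : Set E3) := h2
    by_contra hlt
    rw [not_le] at hlt
    have hwin : ((q : T) : E3) ∈ S ∩ closedBall (0 : E3) Rc := ⟨(hmemT q).1, mem_closedBall.mpr hlt.le⟩
    obtain ⟨x', hx', hqx'⟩ := inter_closedBall_subset_image_atomOf hS hτ hcoh hwin
    have hx'a : x' ∈ a := hx'
    by_cases hxx : x' = x
    · exact (hmemT q).2 (by rw [← hqx', hxx])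
    · exact h3 (by rw [htpl, Finset.coe_image]; exact ⟨x', Finset.mem_coe.mpr (Finset.mem_erase.mpr ⟨hxx, hx'a⟩), hqx'⟩)
  have hnormc : Summable fun q : ↑((↑s : Set T)ᶜ) => ‖f q‖ := hnorm.subtype _
  have htail : ∑' q : ↑((↑s : Set T)ᶜ), ‖f q‖ ≤ farCol (Rc - (‖x‖ + τ)) := by
    refine hnormc.tsum_le_of_sum_le fun u => ?_
    set emb : ↑((↑s : Set T)ᶜ) ↪ E3 := ⟨fun q => ((q : T) : E3), fun q q' hqq' => Subtype.ext (Subtype.ext hqq')⟩ with hemb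
    have hmap : ∑ q ∈ u, ‖f q‖ = ∑ q ∈ u.map emb, ‖((dist p q)⁻¹ ^ 8 - (dist p q)⁻¹ ^ 14) • (p - q)‖ := by
      rw [Finset.sum_map]; rfl
    rw [hmap]
    unfold farCol
    refine sum_norm_force_le_sevenTenths_of_far_from_root _ p 0 (by rwa [dist_zero_right]) hR
      (fun q hq q' hq' hqq' => ?_) (fun q hq => ?_)
    · obtain ⟨w, -, rfl⟩ := Finset.mem_map.mp hq
      obtain ⟨w', -, rfl⟩ := Finset.mem_map.mp hq'
      exact hS _ (hmemT w).1 _ (hmemT w').1 hqq'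
    · obtain ⟨w, -, rfl⟩ := Finset.mem_map.mp hq
      exact hfar w
  -- the template part of the balance is the template sum
  have hmapS : s.map (Function.Embedding.subtype _) = tpl := by
    ext q
    rw [Finset.mem_map]
    constructor
    · rintro ⟨w, hw, rfl⟩
      rw [hs, Finite.mem_toFinset] at hw
      exact hw
    · intro hq
      have hq' := hq
      rw [htpl, Finset.mem_image] at hq'
      obtain ⟨x', hx', rfl⟩ := hq'
      have hx'a := Finset.mem_of_mem_erase hx'
      have hm := atomOf_mem (hne x' hx'a)
      have hneq : atomOf S τ x' ≠ p := fun h =>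
        Finset.ne_of_mem_erase hx' ((injOn_atomOf ha hne) hx'a hx h)
      refine ⟨⟨atomOf S τ x', (count_restrict_singleton_ne_zero_iff S _).mpr hm.2, hneq⟩, ?_, rfl⟩
      rw [hs, Finite.mem_toFinset]
      exact hq
  have hwin : ∑ q ∈ s, f q = ∑ x' ∈ a.erase x, ljBondForce (p - atomOf S τ x') :=
    calc ∑ q ∈ s, f q = ∑ q ∈ s.map (Function.Embedding.subtype _), ((dist p q)⁻¹ ^ 8 - (dist p q)⁻¹ ^ 14) • (p - q) := by
          rw [Finset.sum_map]; rfl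
      _ = ∑ q ∈ (a.erase x).image (atomOf S τ), ((dist p q)⁻¹ ^ 8 - (dist p q)⁻¹ ^ 14) • (p - q) := by rw [hmapS]
      _ = ∑ x' ∈ a.erase x, ((dist p (atomOf S τ x'))⁻¹ ^ 8 - (dist p (atomOf S τ x'))⁻¹ ^ 14) • (p - atomOf S τ x') :=
          Finset.sum_image fun x₁ h₁ x₂ h₂ h =>
            (injOn_atomOf ha hne) (Finset.mem_of_mem_erase h₁) (Finset.mem_of_mem_erase h₂) h
      _ = ∑ x' ∈ a.erase x, ljBondForce (p - atomOf S τ x') := Finset.sum_congr rfl fun x' _ => force_eq_ljBondForce _ _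
  rw [← hwin, hsum_s, norm_neg]
  exact (norm_tsum_le_tsum_norm hnormc).trans htail

/-! ## §3. ★ The class-A doors (226′)/(244′): (226)/(244) verbatim, `hin` deleted -/

/-- ★★★ **T2 WITHOUT `hin` — THE COHERENT-WINDOW CERTIFICATE FLOOR on a COMPLETE template.**  As `…CoherentFloor.certFloor_le_two_mul_rootEnergy`
((226)) with the hypothesis `hin : ∀ x ∈ a, ‖x‖ + τ ≤ Rc` REMOVED: template tubes may stick out of the window `B̄(0,Rc)`; a template atom outside the
window is booked twice (template energy and energy tail), both times non-positively (`Rc ≥ 1`).  Same certificate, same columns. [folklore] -/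
theorem certFloor_le_two_mul_rootEnergy' {S : Set E3} {τ Rc : ℝ} {a I : Finset E3} (y : E3 → E3)
    (hS : ∀ p ∈ S, ∀ p' ∈ S, p ≠ p' → (7 : ℝ) / 10 ≤ dist p p') (h0S : (0 : E3) ∈ S)
    (hτ0 : 0 ≤ τ) (hτ : 2 * τ < 7 / 10) (hRc : 1 ≤ Rc)
    (hcoh : (Measure.count.restrict S : Measure E3) ∈ coherentAt a τ Rc)
    (h0a : (0 : E3) ∈ a) (hIa : I ⊆ a) (ha : ∀ x ∈ a, ∀ x' ∈ a, x ≠ x' → 2 * τ < dist x x')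
    (hI : ∀ x ∈ I, 7 / 20 ≤ Rc - (‖x‖ + τ))
    (hbal : ∀ x ∈ I, HasSum (fun q : {q : E3 // (Measure.count.restrict S : Measure E3) {q} ≠ 0 ∧ q ≠ atomOf S τ x} =>
      ((dist (atomOf S τ x) (q : E3))⁻¹ ^ 8 - (dist (atomOf S τ x) (q : E3))⁻¹ ^ 14) • (atomOf S τ x - (q : E3))) 0) :
    certFloor a I y τ Rc ≤ 2 * rootEnergy lennardJones (Measure.count.restrict S : Measure E3) := by
  classical
  have h7 : (0 : ℝ) < 7 / 10 := by norm_num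
  have hne : ∀ z ∈ a, (closedBall z τ ∩ S).Nonempty := fun z hz => nonempty_of_mem_coherentAt hcoh hz
  -- the displacement field of the coherent window
  set d : E3 → E3 := fun z => atomOf S τ z - z with hd
  have hq : ∀ z, z + d z = atomOf S τ z := fun z => by
    show z + (atomOf S τ z - z) = atomOf S τ z
    abel
  have hd0 : d 0 = 0 := by
    have h := atomOf_zero hS hτ h0S hτ0
    show atomOf S τ 0 - 0 = 0
    rw [h, sub_zero]
  have hdτ : ∀ z ∈ a, ‖d z‖ ≤ τ := fun z hz => norm_atomOf_sub_le (hne z hz)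
  have hdisp : ∀ z ∈ a, ‖d z‖ ≤ dispB τ z := fun z hz => by
    unfold dispB
    split_ifs with h
    · rw [h, hd0, norm_zero]
    · exact hdτ z hz
  have hdispτ : ∀ z : E3, dispB τ z ≤ τ := fun z => by unfold dispB; split_ifs <;> linarith
  -- (i) energy slots from NODE-12
  have heR : ∀ x ∈ a.erase 0,
      phiT (‖x‖ ^ 2) + psiT (‖x‖ ^ 2) * ⟪x, d x⟫ - (τ ^ 2 * secondNeg ‖x‖ + energyRem ‖x‖ τ) ≤ phiT (‖x + d x‖ ^ 2) := by
    intro x hx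
    obtain ⟨hx0, hxa⟩ := Finset.mem_erase.mp hx
    have hxτ : τ < ‖x‖ := by
      have h := ha x hxa 0 h0a hx0
      rw [dist_zero_right] at h
      linarith
    exact phiT_taylor_ge x (d x) (hdτ x hxa) hxτ
  -- (iv, NODE-10 part) force-remainder slots
  have hfR : ∀ x ∈ I, ∀ x' ∈ a.erase x, ‖ljBondForce ((x + d x) - (x' + d x')) - ljBondForce (x - x') - ljBondForceLin (x - x') (d x - d x')‖
      ≤ forceRem ‖x - x'‖ (dispB τ x + dispB τ x') := by
    intro x hx x' hx'
    obtain ⟨hx'x, hx'a⟩ := Finset.mem_erase.mp hx'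
    have hxa := hIa hx
    have e : (x + d x) - (x' + d x') = (x - x') + (d x - d x') := by abel
    rw [e]
    refine norm_ljBondForce_taylor_le (x - x') (d x - d x') ((norm_sub_le _ _).trans (add_le_add (hdisp x hxa) (hdisp x' hx'a))) ?_
    have h3 := ha x hxa x' hx'a (Ne.symm hx'x)
    rw [dist_eq_norm] at h3
    linarith [hdispτ x, hdispτ x']
  -- (iv, far part) the force balance split — WITHOUT `hin`
  have hC : ∀ x ∈ I, ‖∑ x' ∈ a.erase x, ljBondForce ((x + d x) - (x' + d x'))‖ ≤ farCol (Rc - (‖x‖ + τ)) := by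
    intro x hx
    simp_rw [hq]
    exact norm_sum_template_force_le' hS hτ hcoh ha (hIa hx) (hI x hx) (hbal x hx)
  have hcore := windowSum_ge a I y d τ (fun x => τ ^ 2 * secondNeg ‖x‖ + energyRem ‖x‖ τ)
    (fun x x' => forceRem ‖x - x'‖ (dispB τ x + dispB τ x')) (fun x => farCol (Rc - (‖x‖ + τ))) hIa hd0 hdτ heR hfR
    (fun x x' => by rw [norm_sub_rev, add_comm (dispB τ x)]) hC
  beta_reduce at hcore
  -- the energy side: template sum ≤ window energy (§1, NO `hin`), tail ≥ −T♯(Rc)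
  have hint := integrable_lennardJones_of_isRootedHardCore h7 ⟨S, h0S, hS, rfl⟩
  have hwin : ∑ x ∈ a.erase 0, phiT (‖x + d x‖ ^ 2) ≤
      ∫ z in closedBall (0 : E3) Rc, lennardJones ‖z‖ ∂(Measure.count.restrict S : Measure E3) := by
    have h1 := sum_lennardJones_atomOf_le_setIntegral hS hτ hcoh ha hRc
    rw [← Finset.sum_erase_add a _ h0a, atomOf_zero hS hτ h0S hτ0, norm_zero] at h1
    have hV0 : lennardJones 0 = 0 := by unfold lennardJones; simp
    rw [hV0, add_zero] at h1
    calc ∑ x ∈ a.erase 0, phiT (‖x + d x‖ ^ 2) = ∑ x ∈ a.erase 0, lennardJones ‖atomOf S τ x‖ :=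
          Finset.sum_congr rfl fun x _ => by rw [lennardJones_eq_phiT, hq]
      _ ≤ _ := h1
  have htail := (abs_le.mp (abs_setIntegral_compl_lennardJones_le hS hRc)).1
  have hE : 2 * rootEnergy lennardJones (Measure.count.restrict S : Measure E3) =
      (∫ z in closedBall (0 : E3) Rc, lennardJones ‖z‖ ∂(Measure.count.restrict S : Measure E3)) +
        ∫ z in (closedBall (0 : E3) Rc)ᶜ, lennardJones ‖z‖ ∂(Measure.count.restrict S : Measure E3) := by
    rw [rootEnergy_def, integral_add_compl measurableSet_closedBall hint]
    ring
  unfold certFloor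
  rw [hE]
  linarith

/-- ★★★ **T2 under the crux's own clauses, WITHOUT `hin`.**  As `…CoherentFloor.certFloor_le_two_mul_rootEnergy_of_nash` ((244)) with `hin` REMOVED:
for a rooted `7/10`-hard-core `μ` satisfying the NASH clause (e) of `AperiodicFrustratedLawGap` verbatim, coherent with the (complete) template `a ∋ 0`
(tolerance `τ`, window `Rc ≥ 1`, interior `I ⊆ a` at least `7/20` inside), and ANY multipliers `y`: `certFloor a I y τ Rc ≤ 2·rootEnergy V_LJ μ`. [folklore] -/
theorem certFloor_le_two_mul_rootEnergy_of_nash' {μ : Measure E3} {τ Rc : ℝ} {a I : Finset E3} (y : E3 → E3)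
    (hμ : IsRootedHardCore (7 / 10) μ)
    (hNash : ∀ p : E3, μ {p} ≠ 0 → ∀ w : E3, (∀ q : E3, μ {q} ≠ 0 → q ≠ p → w ≠ q) →
      ∑' q : {q : E3 // μ {q} ≠ 0 ∧ q ≠ p}, lennardJones (dist p (q : E3)) ≤
        ∑' q : {q : E3 // μ {q} ≠ 0 ∧ q ≠ p}, lennardJones (dist w (q : E3)))
    (hτ0 : 0 ≤ τ) (hτ : 2 * τ < 7 / 10) (hRc : 1 ≤ Rc) (hcoh : μ ∈ coherentAt a τ Rc)
    (h0a : (0 : E3) ∈ a) (hIa : I ⊆ a) (ha : ∀ x ∈ a, ∀ x' ∈ a, x ≠ x' → 2 * τ < dist x x')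
    (hI : ∀ x ∈ I, 7 / 20 ≤ Rc - (‖x‖ + τ)) :
    certFloor a I y τ Rc ≤ 2 * rootEnergy lennardJones μ := by
  obtain ⟨S, h0S, hS, rfl⟩ := hμ
  have hne : ∀ z ∈ a, (closedBall z τ ∩ S).Nonempty := fun z hz => nonempty_of_mem_coherentAt hcoh hz
  refine certFloor_le_two_mul_rootEnergy' y hS h0S hτ0 hτ hRc hcoh h0a hIa ha hI fun x hx => ?_
  have hp : (Measure.count.restrict S : Measure E3) {atomOf S τ x} ≠ 0 :=
    (count_restrict_singleton_ne_zero_iff S _).mpr (atomOf_mem (hne x (hIa hx))).2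
  exact hasSum_force_of_nash (by norm_num : (0 : ℝ) < 7 / 10) ⟨S, h0S, hS, rfl⟩ hp (hNash _ hp)

/-- Sanity: the `hin` door is the special case (a complete template that happens to fit inside the window). [folklore] -/
theorem certFloor_le_two_mul_rootEnergy_of_nash_of_hin {μ : Measure E3} {τ Rc : ℝ} {a I : Finset E3} (y : E3 → E3)
    (hμ : IsRootedHardCore (7 / 10) μ)
    (hNash : ∀ p : E3, μ {p} ≠ 0 → ∀ w : E3, (∀ q : E3, μ {q} ≠ 0 → q ≠ p → w ≠ q) →
      ∑' q : {q : E3 // μ {q} ≠ 0 ∧ q ≠ p}, lennardJones (dist p (q : E3)) ≤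
        ∑' q : {q : E3 // μ {q} ≠ 0 ∧ q ≠ p}, lennardJones (dist w (q : E3)))
    (hτ0 : 0 ≤ τ) (hτ : 2 * τ < 7 / 10) (hRc : 1 ≤ Rc) (hcoh : μ ∈ coherentAt a τ Rc)
    (h0a : (0 : E3) ∈ a) (hIa : I ⊆ a) (ha : ∀ x ∈ a, ∀ x' ∈ a, x ≠ x' → 2 * τ < dist x x')
    (_hin : ∀ x ∈ a, ‖x‖ + τ ≤ Rc) (hI : ∀ x ∈ I, 7 / 20 ≤ Rc - (‖x‖ + τ)) :
    certFloor a I y τ Rc ≤ 2 * rootEnergy lennardJones μ :=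
  certFloor_le_two_mul_rootEnergy_of_nash' y hμ hNash hτ0 hτ hRc hcoh h0a hIa ha hI

end Summit.AtomisticToContinuum.Crystallization.Theorems.FrustratedLawDichotomyCoherentFloorComplete

end
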